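import Literature.NumberTheory.DiophantineGeometry.AVGaloisModule
import Literature.NumberTheory.EllipticCurves.TateModuleRank
import HarnessLib

/-!
# `rank_{ℤ_ℓ} T_ℓ A = 2 dim A` from `#A[n](K̄) = n^{2 dim A}` (Serre–Tate 1968, §1)

Sibling proof file of `Literature/NumberTheory/DiophantineGeometry/AVGaloisModule.lean`, which
records as named facts, for an abelian variety `A` over a field `K` and a prime `ℓ`,

* `Literature.AlgebraicGeometry.Motives.AbelianVariety.finrank_tateModule_eq A ℓ` — for `ℓ`
  invertible in `K`, `rank_{ℤ_ℓ} T_ℓ A = 2 dim A`;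
* `Literature.AlgebraicGeometry.Motives.AbelianVariety.finrank_rationalTateModule_eq A ℓ` — for `ℓ`
  invertible in `K`, `dim_{ℚ_ℓ} V_ℓ A = 2 dim A`.

## Source and architecture of the printed proof

J.-P. Serre, J. Tate, *Good reduction of abelian varieties*, Ann. of Math. (2) **88** (1968),
492–517, §1, p. 493: "if `l` is a prime number, `l ≠ char(K)`, we put
`T_l(A) = inv lim A_{lⁿ} = Hom(Q_l/Z_l, A(K_s))`. This is a free module of rank `2 dim(A)` over the
ring `Z_l` of `l`-adic integers", the input being (same page) "`A_m` is a free `Z/mZ`-module of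
rank `2 dim(A)`" for `m` prime to `char(K)`, quoted from Lang, *Abelian Varieties*, Ch. VII
(Mumford, *Abelian Varieties*, §6, Proposition p. 64 and Appendix to §7; in the tree the named
fact `Literature.AlgebraicGeometry.Motives.AbelianVariety.natCard_torsionPoints_of_isAlgClosed`,
`#A[n](L) = n^{2 dim A}` for `L ⊇ K` algebraically closed and `n` invertible in `K`).

Accordingly this file proves the **reductions**

* `AbelianVariety.finrank_tateModule_eq_of_natCard_torsionPoints :
    A.natCard_torsionPoints_of_isAlgClosed K̄ → A.finrank_tateModule_eq ℓ`,
* `AbelianVariety.finrank_rationalTateModule_eq_of_natCard_torsionPoints :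
    A.natCard_torsionPoints_of_isAlgClosed K̄ → A.finrank_rationalTateModule_eq ℓ`,

by the passage to the limit "`#A[ℓⁿ] = ℓ^{2gn}` for all `n` ⇒ `T_ℓ A ≅ ℤ_ℓ^{2g}`", which is the
generic structure theorem `Literature.NumberTheory.EllipticCurves.TateModule.finrank_eq_of_card_torsionBy`
(rank `d`, any abelian group; file `Literature.NumberTheory.EllipticCurves.TateModuleRank`:
surjectivity of `[ℓ] : A[ℓⁿ⁺¹] → A[ℓⁿ]` by counting, compatible bases, gluing of coordinates in
`ℤ_ℓ = lim ℤ/ℓⁿ`), applied with `d = 2 dim A` to the counts `natCard_geomTorsion_pow` below.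

The deep input `natCard_torsionPoints_of_isAlgClosed` (degree `n^{2g}` and étaleness of `[n]_A`)
is a named fact of `Literature.AlgebraicGeometry.Motives.AbelianVariety` without a discharge in the
tree (it is reduced to line-bundle facts in `Literature.AlgebraicGeometry.Motives.AbelianVarietyDegree`),
so `finrank_tateModule_eq_holds` itself is **not** asserted here; granted
`natCard_torsionPoints_of_isAlgClosed_holds`, it is the one-liner
`A.finrank_tateModule_eq_of_natCard_torsionPoints ℓ (natCard_torsionPoints_of_isAlgClosed_holds …)`.
No new named fact is introduced.

## References

* [SerreTate1968] J.-P. Serre, J. Tate, *Good reduction of abelian varieties*, Ann. of Math. (2)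
  88 (1968), 492–517, §1 (p. 493). doi:10.2307/1970722
* [MumfordAV1970] D. Mumford, *Abelian Varieties*, §6 (Proposition p. 64), §19 (p. 171).
* [SilvermanAEC2009] J. H. Silverman, *The Arithmetic of Elliptic Curves*, 2nd ed., Prop. III.7.1(a)
  (the case `g = 1`, same argument).
-/

noncomputable section

universe u

namespace Literature.NumberTheory.DiophantineGeometry

section AbelianVariety
open Literature.AlgebraicGeometry.Motives (AbelianVariety)
open Literature.AlgebraicGeometry.Motives.AbelianVariety

variable {K : Type u} [Field K] (A : AbelianVariety K) (ℓ : ℕ)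

/-- **Counts of the `ℓ`-power torsion.** For `ℓ` invertible in `K` and every `n`,
`#A[ℓⁿ](K̄) = ℓ^{2 dim A · n}`, granted the named fact `#A[m](K̄) = m^{2 dim A}` for `m`
invertible in `K` (`natCard_torsionPoints_of_isAlgClosed`; Mumford, *Abelian Varieties*, §6,
Proposition p. 64; Serre–Tate 1968, §1, p. 493: "`A_m` is a free `Z/mZ`-module of rank
`2 dim(A)`"), via `natCard_geomTorsion` at `m = ℓⁿ`. [cite: SerreTate1968, §1 p. 493] -/
theorem _root_.Literature.AlgebraicGeometry.Motives.AbelianVariety.natCard_geomTorsion_pow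
    (h : A.natCard_torsionPoints_of_isAlgClosed (AlgebraicClosure K)) (hℓ : (ℓ : K) ≠ 0) (n : ℕ) :
    Nat.card (A.geomTorsion (ℓ ^ n : ℕ)) = ℓ ^ (2 * A.dim * n) := by
  have hℓn : (((ℓ ^ n : ℕ) : ℤ) : K) ≠ 0 := by
    rw [Int.cast_natCast, Nat.cast_pow]
    exact pow_ne_zero _ hℓ
  rw [A.natCard_geomTorsion h _ hℓn, Int.natAbs_natCast, ← pow_mul, Nat.mul_comm n]

variable [Fact ℓ.Prime]

/-- **Serre–Tate 1968, §1 (p. 493), `T_ℓ(A)` "is a free module of rank `2 dim(A)` over `Z_ℓ`",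
reduced to the torsion count.** The named fact `finrank_tateModule_eq A ℓ`
(`rank_{ℤ_ℓ} T_ℓ A = 2 dim A` for `ℓ` invertible in `K`) follows from the named fact
`natCard_torsionPoints_of_isAlgClosed A K̄` (`#A[m](K̄) = m^{2 dim A}`, Mumford §6 / Lang,
*Abelian Varieties*, Ch. VII, the input quoted by Serre–Tate): `#A[ℓⁿ](K̄) = ℓ^{2gn}` for all `n`
(`natCard_geomTorsion_pow`) forces `T_ℓ A = lim A[ℓⁿ] ≅ ℤ_ℓ^{2g}`
(`Literature.NumberTheory.EllipticCurves.TateModule.finrank_eq_of_card_torsionBy`, rank `d = 2 dim A`).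
[cite: SerreTate1968, §1 p. 493] -/
theorem _root_.Literature.AlgebraicGeometry.Motives.AbelianVariety.finrank_tateModule_eq_of_natCard_torsionPoints
    (h : A.natCard_torsionPoints_of_isAlgClosed (AlgebraicClosure K)) :
    A.finrank_tateModule_eq ℓ := by
  intro hℓ
  exact EllipticCurves.TateModule.finrank_eq_of_card_torsionBy (A := A.geomPoints) (p := ℓ)
    (d := 2 * A.dim) (A.natCard_geomTorsion_pow ℓ h hℓ)

/-- **`dim_{ℚ_ℓ} V_ℓ A = 2 dim A` for `ℓ` invertible in `K`, reduced to the torsion count.** The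
named fact `finrank_rationalTateModule_eq A ℓ` (Mumford §19, p. 172; `V_ℓ = ℚ_ℓ ⊗ T_ℓ` with
`T_ℓ ≅ ℤ_ℓ^{2g}`, Serre–Tate 1968, §1, p. 493) follows from `natCard_torsionPoints_of_isAlgClosed A K̄`
by `Literature.NumberTheory.EllipticCurves.RationalTateModule.finrank_eq_of_card_torsionBy`
(base change of the structure theorem, Mathlib `Module.finrank_baseChange`).
[cite: SerreTate1968, §1 p. 493] [cite: MumfordAV1970, §19 p. 172] -/
theorem _root_.Literature.AlgebraicGeometry.Motives.AbelianVariety.finrank_rationalTateModule_eq_of_natCard_torsionPoints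
    (h : A.natCard_torsionPoints_of_isAlgClosed (AlgebraicClosure K)) :
    A.finrank_rationalTateModule_eq ℓ := by
  intro hℓ
  exact EllipticCurves.RationalTateModule.finrank_eq_of_card_torsionBy (A := A.geomPoints) (p := ℓ)
    (d := 2 * A.dim) (A.natCard_geomTorsion_pow ℓ h hℓ)

/-- **`T_ℓ A ≅ ℤ_ℓ^{2 dim A}` as `ℤ_ℓ`-modules for `ℓ` invertible in `K`** (the structure statement
behind `finrank_tateModule_eq`; Serre–Tate 1968, §1, p. 493; Mumford §19, p. 171), granted
`natCard_torsionPoints_of_isAlgClosed A K̄`: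
`Literature.NumberTheory.EllipticCurves.TateModule.nonempty_linearEquiv_of_card_torsionBy` with
`d = 2 dim A`. [cite: SerreTate1968, §1 p. 493] -/
theorem _root_.Literature.AlgebraicGeometry.Motives.AbelianVariety.nonempty_tateModule_linearEquiv_of_natCard_torsionPoints
    (h : A.natCard_torsionPoints_of_isAlgClosed (AlgebraicClosure K)) (hℓ : (ℓ : K) ≠ 0) :
    Nonempty (A.tateModule ℓ ≃ₗ[ℤ_[ℓ]] (Fin (2 * A.dim) → ℤ_[ℓ])) :=
  EllipticCurves.TateModule.nonempty_linearEquiv_of_card_torsionBy (A := A.geomPoints) (p := ℓ)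
    (d := 2 * A.dim) (A.natCard_geomTorsion_pow ℓ h hℓ)

end AbelianVariety

end Literature.NumberTheory.DiophantineGeometry
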